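import Summits.QuantumFields.YangMills.Theorems.LuscherReductionTwistedTraceScalingCoarseUpperOfHOD
import HarnessLib

/-!
# The VALLEY GAIN at every core radius `β^{−a}`, `0 < a < 1/5`: `ValleyGainAt L (powScale a) (powScale (17/20))` UNCONDITIONAL for `L ≥ 2`
# (lane A of S-BASE, crux `TwistedTraceScaling` stmt-QuantumFields-20203, line «twolattice», stub `stub_fixedLatticeTraceLaw`; lead g23)

Exported by-products of the COARSE-UPPER(L) chain (✓`coarseUpper`), for the next pens (COARSE-LOWER(L): the sup bound on `λ₀` in `recordSigma·μ₀`-currency uses the onion at the core radius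
with THIS valley gain; cdisprove's L-uniformity audits):
* ★★★ `valleyGain_thinShells (hL2)` — `ValleyGainAt L (powScale (17/100)) (powScale (17/20))` (RED's `V(1/40)` pushed through the eight thin shells, all discharged by ✓`hOD_record_low`);
* ★★★ `valleyGain_record (hL2) (ha0 : 0 < a) (ha5 : a < 1/5)` — `ValleyGainAt L (powScale a) (powScale (17/20))` for EVERY `0 < a < 1/5` (one more thin shell `(a, 17/100)` when
  `17/100 < a`, ✓`innerShellGainSmallAt_record`; monotonicity in the radius otherwise);
* ★★★ `shellGain_record (hL2) (ha0 : 0 < a) (ha5 : a < 1/5) (b)` — `InnerShellGainSmallAt L (powScale a) (powScale b) (powScale (17/20))` for EVERY outer exponent `b` (valley gain ⇒ shell gain,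
  the inclusion of R22 ✓`innerShellGainSmallAt_of_valleyGainAt`, proved here directly).
HONEST FRAMING: fixed-`L` by-products of the CONDITIONAL route R2b1's S-BASE upper third; COARSE-LOWER/TAIL, the stubs and the crux stay OPEN; not infinite volume, not a mass gap, not Clay.
No definitions, no `sorry`.
-/

set_option autoImplicit false

noncomputable section

open MeasureTheory Filter Topology Real
open scoped BigOperators
open Literature.MathematicalPhysics.QuantumFieldTheory
open Literature.MathematicalPhysics.QuantumLattice

namespace Summit.QuantumFields.YangMills.Theorems.FemtoTransferGap.TwoLattice.ConstTube

open Summit.QuantumFields.YangMills.Theorems.FemtoTransferGap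

variable {L : ℕ} [NeZero L]

/-- The (B-OD) schema below `1/4`, discharged by hand A's ✓`hOD_record_low`. [cite: Luscher1983, §3] -/
theorem hODlow_record (hL2 : 2 ≤ L) (s : ℝ) (hs : 0 < s) (hs4 : s < 1 / 4) :
    ∃ M₀ : ℝ, ∀ M : ℝ, M₀ ≤ M → ∃ b : ℝ → ℝ, (∀ β, 0 ≤ b β) ∧
      (∀ p : ℝ, p < 2 * s → p < 1 / 3 → ∀ᶠ β : ℝ in atTop, b β ^ 2 ≤ powScale p β) ∧
      ∀ᶠ β : ℝ in atTop, ∀ (φ : GaugeConfig 3 1 SU2 → ℝ) (v : GaugeConfig 3 L SU2 → ℝ), Measurable φ → (∃ C : ℝ, ∀ u, |φ u| ≤ C) →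
        (∀ u, φ u ≠ 0 → orbitDist u < recordDelta1 L s β) → Measurable v → (∃ C : ℝ, ∀ U, |v U| ≤ C) → (∀ U, v U ≠ 0 → recordChi L s 43 M β U ≠ 0) →
        (∀ u, fibreInner L (softWeight (recordChi L s 43 M β)) (recordProfile L β) v u = 0) →
        |tubeCross β (boFun L φ (recordProfile L β)) v| ≤ b β * (recordSigma L β * levelValue su2Rep 1 ((L : ℝ) ^ 3 * β) 0) *
            Real.sqrt (tubeNormSq (softWeight (recordChi L s 43 M β)) (boFun L φ (recordProfile L β))) * Real.sqrt (tubeNormSq (softWeight (recordChi L s 43 M β)) v) ∧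
        |tubeCross β v (boFun L φ (recordProfile L β))| ≤ b β * (recordSigma L β * levelValue su2Rep 1 ((L : ℝ) ^ 3 * β) 0) *
            Real.sqrt (tubeNormSq (softWeight (recordChi L s 43 M β)) (boFun L φ (recordProfile L β))) * Real.sqrt (tubeNormSq (softWeight (recordChi L s 43 M β)) v) := by
  obtain ⟨M₀, -, h⟩ := hOD_record_low (L := L) (nonempty_nzSite_of_two_le hL2) hL2 hs hs4
  exact ⟨M₀, h⟩

/-- ★★★ **`V(17/100)`**: `ValleyGainAt L (powScale (17/100)) (powScale (17/20))`, unconditional for `L ≥ 2`. [cite: Luscher1983, §3] [cite: LuscherMunster1984, §2] -/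
theorem valleyGain_thinShells (hL2 : 2 ≤ L) : ValleyGainAt L (powScale (17 / 100)) (powScale (17 / 20)) :=
  valleyGain_of_thinShells hL2
    (innerShellGainSmallAt_record_low hL2 (s := 13 / 100) (a := 17 / 100) (by norm_num) (by norm_num) (by norm_num) (by norm_num) (by norm_num) (hODlow_record hL2 _ (by norm_num) (by norm_num)) _)
    (innerShellGainSmallAt_record_low hL2 (s := 1 / 10) (a := 13 / 100) (by norm_num) (by norm_num) (by norm_num) (by norm_num) (by norm_num) (hODlow_record hL2 _ (by norm_num) (by norm_num)) _)
    (innerShellGainSmallAt_record_low hL2 (s := 77 / 1000) (a := 1 / 10) (by norm_num) (by norm_num) (by norm_num) (by norm_num) (by norm_num) (hODlow_record hL2 _ (by norm_num) (by norm_num)) _)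
    (innerShellGainSmallAt_record_low hL2 (s := 59 / 1000) (a := 77 / 1000) (by norm_num) (by norm_num) (by norm_num) (by norm_num) (by norm_num) (hODlow_record hL2 _ (by norm_num) (by norm_num)) _)
    (innerShellGainSmallAt_record_low hL2 (s := 45 / 1000) (a := 59 / 1000) (by norm_num) (by norm_num) (by norm_num) (by norm_num) (by norm_num) (hODlow_record hL2 _ (by norm_num) (by norm_num)) _)
    (innerShellGainSmallAt_record_low hL2 (s := 34 / 1000) (a := 45 / 1000) (by norm_num) (by norm_num) (by norm_num) (by norm_num) (by norm_num) (hODlow_record hL2 _ (by norm_num) (by norm_num)) _)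
    (innerShellGainSmallAt_record_low hL2 (s := 26 / 1000) (a := 34 / 1000) (by norm_num) (by norm_num) (by norm_num) (by norm_num) (by norm_num) (hODlow_record hL2 _ (by norm_num) (by norm_num)) _)
    (innerShellGainSmallAt_record_low hL2 (s := 1 / 40) (a := 26 / 1000) (by norm_num) (by norm_num) (by norm_num) (by norm_num) (by norm_num) (hODlow_record hL2 _ (by norm_num) (by norm_num)) _)

/-- Monotonicity of the valley gain in the inner radius: a larger inner radius (smaller exponent) is a smaller valley. [folklore] -/
theorem valleyGainAt_pow_mono {a a' q : ℝ} (haa : a ≤ a') (hV : ValleyGainAt L (powScale a') (powScale q)) : ValleyGainAt L (powScale a) (powScale q) := by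
  intro A
  obtain ⟨β0, h⟩ := hV A
  refine ⟨β0, fun β hβ φ hφ hsupp => h β hβ φ hφ fun U hU => ⟨(hsupp U hU).1, fun z => ?_⟩⟩
  have h1 := (hsupp U hU).2 z
  have h2 : powScale a' β ≤ powScale a β := powScale_le_powScale haa β
  linarith

/-- ★★★ **THE VALLEY GAIN AT EVERY CORE RADIUS** `β^{−a}`, `0 < a < 1/5`: `ValleyGainAt L (powScale a) (powScale (17/20))`, unconditional for `L ≥ 2`. [cite: Luscher1983, §3] [cite: LuscherMunster1984, §2] -/
theorem valleyGain_record (hL2 : 2 ≤ L) {a : ℝ} (ha0 : 0 < a) (ha5 : a < 1 / 5) : ValleyGainAt L (powScale a) (powScale (17 / 20)) := by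
  by_cases ha : a ≤ 17 / 100
  · exact valleyGainAt_pow_mono ha (valleyGain_thinShells hL2)
  · push Not at ha
    exact valleyGainAt_pow_of_shellSmall (by norm_num) (by norm_num)
      (innerShellGainSmallAt_record hL2 (b := 17 / 100) (by norm_num) (by norm_num) ha0 ha5 (17 / 20)) (valleyGain_thinShells hL2)

/-- ★★★ **THE SHELL GAIN AT EVERY PAIR OF RADII** at the record layer: `InnerShellGainSmallAt L (powScale a) (powScale b) (powScale (17/20))` for `0 < a < 1/5` and ANY outer exponent `b`
(a shell function is a valley function). [cite: Luscher1983, §3] -/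
theorem shellGain_record (hL2 : 2 ≤ L) {a : ℝ} (ha0 : 0 < a) (ha5 : a < 1 / 5) (b : ℝ) : InnerShellGainSmallAt L (powScale a) (powScale b) (powScale (17 / 20)) := by
  intro A
  obtain ⟨β0, h⟩ := valleyGain_record hL2 ha0 ha5 A
  exact ⟨β0, fun β hβ φ hφ hsupp => h β hβ φ hφ fun U hU => ⟨(hsupp U hU).1, (hsupp U hU).2.2⟩⟩

end Summit.QuantumFields.YangMills.Theorems.FemtoTransferGap.TwoLattice.ConstTube

end
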